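import Summits.BirchSwinnertonDyer.Rank1Residual.ManinAdditive.ShimuraKernelCyclic
import Summits.BirchSwinnertonDyer.BirchSwinnertonDyer.Theorems.ManinLocalTwoThreeCDivisionAssembly
import Summits.BirchSwinnertonDyer.BirchSwinnertonDyer.Theorems.ManinLocalTwoThreeCDivisionNeronPeriodsConsumers
import HarnessLib

/-!
# THE SHIMURA KERNEL IS CYCLIC ⟹ E-an-152c and C2 modulo CDT — the route-cone compositions (desc g26, MEMO-desc §51; sibling of `ShimuraKernelCyclic.lean`)

The two theorems of desc's Sketch-desc-g26.lean v2 0b228e6b9af6014f that name route-cone declarations, VERBATIM: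
`shimuraIndexNeFourAtFourOddSquarefree_of_notInsideTwice : row 1 → CDivisionNeron.ShimuraIndexNeFourAtFourOddSquarefree` (E-an-152c, the residual
of the C2 line of record; `Theorems/…CDivisionNeronPeriodsConsumers`, p755600) and **`maninOddAtFour_of_CDT_notInsideTwice : CDT_algInt →
Gamma1PeriodsNotInsideTwiceGamma0Periods → Theses.ManinLocalTwoThree.ManinOddAtFour`** (through `CDivAssembly.maninOddAtFour_of_CDT_indexNeFour`,
p754408).  Kept out of the route-independent leaf because both imports are inside the `Theses.ManinLocalTwoThree` cone (HOME/typer/README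
gotcha 96/118).  CONDITIONAL implications only (hypotheses: the printed CDT Prop and the OPEN row E-desc-g26-1, a paper theorem of MEMO-desc §51
pending ref1 R-desc-g26); priced per the director's 00:56Z freeze.  C2, Manin's conjecture and BSD are NOT proved by this.

TYPER NOTE (typer g21, T-desc-g26 sibling): theorem text verbatim from the sketch §2; namespace `…ManinAdditive.ShimuraCyclic`; kind proof.
APPEND (typer g21, T-desc-g26 v3 626a367b88d23d06): the two cone-side consumers of the kernel-checked edge row 2 ⟹ row 1 —
`shimuraIndexNeFourAtFourOddSquarefree_of_shimuraKernelCyclic` (⊢ E-an-152c) and **`maninOddAtFour_of_CDT_shimuraKernelCyclic : CDT → ShimuraKernelCyclic → ManinOddAtFour`** — VERBATIM.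
APPEND 2 (typer g21, T-desc-g26 v4 4c550eb56d9271be): `maninOddAtFour_of_CDT_newformCyclic : CDT → NewformShimuraKernelCyclic → ManinOddAtFour` VERBATIM.
[cite: CalegariDimitrovTang2025, Thm. 1.0.1]
-/

noncomputable section

open scoped MatrixGroups ModularForm Manifold
open CongruenceSubgroup Complex ModularGroup
open WeierstrassCurve Literature.NumberTheory.EllipticCurves Literature.NumberTheory.EllipticCurves.ModularForms
open Literature.NumberTheory.Automorphic
open Summit.BirchSwinnertonDyer.Rank1Residual.ManinAdditive.ShimuraKernel
open Summit.BirchSwinnertonDyer.Rank1Residual.ManinAdditive.KummerDiamond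
open Summit.BirchSwinnertonDyer.BirchSwinnertonDyer.Theorems.ManinLocalTwoThree

namespace Summit.BirchSwinnertonDyer.Rank1Residual.ManinAdditive.ShimuraCyclic

/-- **Row 1 ⟹ E-an-152c `ShimuraIndexNeFourAtFourOddSquarefree`** (the residual of the C2 line of record). -/
theorem shimuraIndexNeFourAtFourOddSquarefree_of_notInsideTwice (h : Gamma1PeriodsNotInsideTwiceGamma0Periods) :
    CDivisionNeron.ShimuraIndexNeFourAtFourOddSquarefree := by
  intro W₀ _ _ N _ D₀ _h₀ _h4 _hsq
  exact periodLatticeGamma1_ne_two_mul_of_notInsideTwice h W₀ D₀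

/-- **C2 `ManinOddAtFour` ⟸ CDT ∧ Row 1** (through the landed `CDivAssembly.maninOddAtFour_of_CDT_indexNeFour`).  CONDITIONAL on both;
C2, Manin's conjecture and BSD are NOT proved by this. [cite: CalegariDimitrovTang2025, Thm. 1.0.1] -/
theorem maninOddAtFour_of_CDT_notInsideTwice
    (hCDT : Literature.NumberTheory.Automorphic.CalegariDimitrovTang2025_unboundedDenominators_algInt)
    (h : Gamma1PeriodsNotInsideTwiceGamma0Periods) :
    Summit.BirchSwinnertonDyer.BirchSwinnertonDyer.Theses.ManinLocalTwoThree.ManinOddAtFour :=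
  CDivAssembly.maninOddAtFour_of_CDT_indexNeFour hCDT (shimuraIndexNeFourAtFour_of_notInsideTwice h)

/-- Row 2 ⟹ E-an-152c. -/
theorem shimuraIndexNeFourAtFourOddSquarefree_of_shimuraKernelCyclic (h : ShimuraKernelCyclic) :
    CDivisionNeron.ShimuraIndexNeFourAtFourOddSquarefree :=
  shimuraIndexNeFourAtFourOddSquarefree_of_notInsideTwice (notInsideTwice_of_shimuraKernelCyclic h)

/-- **C2 from CDT and the cyclic Shimura kernel** (one-line consumer through the landed C-division assembly). -/
theorem maninOddAtFour_of_CDT_shimuraKernelCyclic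
    (hCDT : Literature.NumberTheory.Automorphic.CalegariDimitrovTang2025_unboundedDenominators_algInt)
    (h : ShimuraKernelCyclic) :
    Summit.BirchSwinnertonDyer.BirchSwinnertonDyer.Theses.ManinLocalTwoThree.ManinOddAtFour :=
  maninOddAtFour_of_CDT_notInsideTwice hCDT (notInsideTwice_of_shimuraKernelCyclic h)

/-- **C2 from CDT and the `f`-only cyclic-kernel row.** CONDITIONAL on both; C2 / Manin / BSD NOT proved here.
[cite: CalegariDimitrovTang2025, Thm. 1.0.1] -/
theorem maninOddAtFour_of_CDT_newformCyclic
    (hCDT : Literature.NumberTheory.Automorphic.CalegariDimitrovTang2025_unboundedDenominators_algInt)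
    (h : NewformShimuraKernelCyclic) :
    Summit.BirchSwinnertonDyer.BirchSwinnertonDyer.Theses.ManinLocalTwoThree.ManinOddAtFour :=
  maninOddAtFour_of_CDT_shimuraKernelCyclic hCDT (shimuraKernelCyclic_of_newform h)

end Summit.BirchSwinnertonDyer.Rank1Residual.ManinAdditive.ShimuraCyclic

end
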